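import Summits.HodgeConjecture.CorCM.IrreducibleOddWeightsCommutantDensity
import Summits.HodgeConjecture.CorCM.IrreducibleOddWeightsIsotypicMultiplicity
import HarnessLib

/-!
# Density over the commutant, IV (shadows): `dim S(Σ_j ι_j b_j) · δ = dim D⟨b⟩ · dim A` and THE CLASS DEFECT
# `dim(S(w₀) ∩ S(w₁)) · δ = dim(D⟨b⟩ ∩ D⟨b′⟩) · dim A` for an ARBITRARY commutant

COR-CM (cell `pub-hodgecm2`, binder seat `b16` gen 72, count-neutral claim DENSITY OVER THE COMMUTANT, file C4 —
abstract `G`-set level; theorems only, no definition, no named fact, no `sorry`).  NEW as stated, hence under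
`Summits/`.  HONEST FRAMING: linear algebra of translates of functions on finite `G`-sets (file C3's dimension
formula for diagonal orbit modules read through gen 70's assembly lemma, file I9 §1); it removes the hypothesis
«scalar commutant» from gen 70's multiplicity files I9/I15 — the price is the factor `δ = [D:ℚ]` and D-SPANS in place
of ℚ-spans: the class defect of `dim Hg(A₀)+dim Hg(A₁)−dim Hg(A₀×A₁)` counts the D-LINEAR RELATIONS between the
components of the two shadows.  `HC_CM` is neither used nor asserted.

SETTING (as in I9).  A reference stable irreducible `A ≤ ℚ^{Y}` (`Y` a finite `G`-set, translates `f ↦ f(k·)`), its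
commutant `𝒟` (a parameter with `h𝒟 : L ∈ 𝒟 ↔ (L(A) ⊆ A ∧ L` commutes with the translates on `A)`), `δ = dim D·a₀`
for any `0 ≠ a₀ ∈ A`; for each `j`, a linear `ι_j : ℚ^{Y} → ℚ^{Y₀}` EQUIVARIANT on `A`, the family jointly
INDEPENDENT on `A`; a tuple `b : J → A`, the shadow `w₀ = Σ_j ι_j(b_j)` and its shadow-coefficient space
`S(w₀) = span{g ↦ w₀(g·y) : y}`; `D⟨b⟩ = ⨆_j D·b_j`.

* §1 **`dim S(Σ_j ι_j b_j) · δ = dim D⟨b⟩ · dim A`** (`finrank_span_shadowCoeff_sum_mul_eq`), and the D-rank form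
  `dim S = r · dim A`, `dim D⟨b⟩ = r · δ` (`exists_rank_finrank_span_shadowCoeff_sum_eq`).
* §2 **THE CLASS DEFECT** for a second pivot `Y₁`, embeddings `ι′_k` and `w₁ = Σ_k ι′_k(b′_k)`:
  **`dim(S(w₀) ∩ S(w₁)) · δ = dim(D⟨b⟩ ∩ D⟨b′⟩) · dim A`** (`finrank_span_shadowCoeff_inf_mul_eq`, through the
  disjoint-union pivot `Y₀ ⊕ Y₁`, `S(w₀ ⊔ w₁) = S(w₀) + S(w₁)`, `D⟨b ⊔ b′⟩ = D⟨b⟩ + D⟨b′⟩`, and Grassmann twice);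
  **`S(w₀) ∩ S(w₁) = 0 ⟺ D⟨b⟩ ∩ D⟨b′⟩ = 0`** (`span_shadowCoeff_inf_eq_bot_iff_iSup`); the defect is EXACTLY
  `m · dim A` with `dim(D⟨b⟩ ∩ D⟨b′⟩) = m·δ` (`exists_finrank_span_shadowCoeff_inf_eq_mul`; I5 gave `dim A ∣ defect`).
* §3 ONE COMPONENT PER SIDE (`w₀ = ι(b)`, `w₁ = ι′(b′)`): the defect is **`dim A` if `b′ ∈ D·b`** (the COMMUTANT
  CERTIFICATE — for gen 69's base #552 a `ℚ(√2)`-valued one) **and `0` otherwise** (D-lines are equal or disjoint,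
  file C1): gen 69's dichotomy `{0, dim A}` with its exact criterion for an arbitrary commutant.

## References

* [Lang2002] S. Lang, *Algebra*, 3rd ed., XVII §3 (density), XVII §1.
* [Serre1977] J.-P. Serre, *Linear Representations of Finite Groups*, GTM 42, §2.6.
* [Gordon1999HodgeAVSurvey] B. B. Gordon, *A survey of the Hodge conjecture for abelian varieties*, §3, 7.5–7.7.
* [Deligne1982HodgeCycles] P. Deligne, *Hodge cycles on abelian varieties*, LNM 900, I §3 Ex. 3.7.
-/

set_option autoImplicit false

noncomputable section

open scoped BigOperators Classical

universe u u' v v' v'' w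

namespace Summit.HodgeConjecture.CorCM.IrrOdd

variable {G : Type w} [Group G] {Y : Type v} [MulAction G Y] [Fintype Y]
  {Y₀ : Type v'} [MulAction G Y₀] [Fintype Y₀] {Y₁ : Type v''} [MulAction G Y₁] [Fintype Y₁]

/-! ### §1 One pivot: `dim S(Σ_j ι_j b_j) · δ = dim D⟨b⟩ · dim A` -/

/-- **THE D-RANK OF A SHADOW IN AN ISOTYPIC CLASS**: `A` stable irreducible (ANY commutant `𝒟`), `ι_j` equivariant
and jointly independent on `A`, `b : J → A`, `0 ≠ a₀ ∈ A`.  There is `r ≤ |J|` with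
**`dim S(Σ_j ι_j b_j) = r · dim A` and `dim D⟨b⟩ = r · δ`**. [cite: Lang2002, XVII §3] [cite: Serre1977, §2.6] -/
theorem exists_rank_finrank_span_shadowCoeff_sum_eq {A : Submodule ℚ (Y → ℚ)}
    {𝒟 : Submodule ℚ ((Y → ℚ) →ₗ[ℚ] (Y → ℚ))}
    (h𝒟 : ∀ L : (Y → ℚ) →ₗ[ℚ] (Y → ℚ), L ∈ 𝒟 ↔ (∀ a ∈ A, L a ∈ A) ∧
      ∀ (k : G) (a : Y → ℚ), a ∈ A → L (fun y => a (k • y)) = fun y => L a (k • y))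
    (hAst : ∀ (k : G) (a : Y → ℚ), a ∈ A → (fun y => a (k • y)) ∈ A)
    (hAirr : ∀ W : Submodule ℚ (Y → ℚ), W ≤ A → W ≠ ⊥ →
      (∀ (k : G) (f : Y → ℚ), f ∈ W → (fun y => f (k • y)) ∈ W) → W = A)
    {J : Type u} [Fintype J] (ι : J → ((Y → ℚ) →ₗ[ℚ] (Y₀ → ℚ)))
    (hιeq : ∀ (j : J) (k : G) (a : Y → ℚ), a ∈ A → ι j (fun y => a (k • y)) = fun y => ι j a (k • y))
    (hind : ∀ f : J → (Y → ℚ), (∀ j, f j ∈ A) → ∑ j, ι j (f j) = 0 → ∀ j, f j = 0)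
    {b : J → (Y → ℚ)} (hb : ∀ j, b j ∈ A) {a₀ : Y → ℚ} (ha₀ : a₀ ∈ A) (h0 : a₀ ≠ 0) :
    ∃ r : ℕ, r ≤ Fintype.card J ∧
      Module.finrank ℚ ↥(⨆ j, 𝒟.map (LinearMap.applyₗ (b j))) =
        r * Module.finrank ℚ ↥(𝒟.map (LinearMap.applyₗ a₀)) ∧
      Module.finrank ℚ ↥(Submodule.span ℚ (Set.range fun y : Y₀ => fun g : G => (∑ j, ι j (b j)) (g • y))) =
        r * Module.finrank ℚ A := by
  rw [finrank_span_shadowCoeff_sum_eq_finrank_span_diag_orbit hAst ι hιeq hind hb]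
  let T : G → (Y → ℚ) →ₗ[ℚ] (Y → ℚ) := fun k => LinearMap.funLeft ℚ ℚ (fun y : Y => k • y)
  have h1 : ∃ i₀ : G, T i₀ = LinearMap.id :=
    ⟨1, LinearMap.ext fun f => funext fun y => by simp [T, LinearMap.funLeft_apply]⟩
  have hmul : ∀ i i' : G, ∃ i'' : G, T i'' = T i ∘ₗ T i' :=
    fun i i' => ⟨i' * i, LinearMap.ext fun f => funext fun y => by simp [T, LinearMap.funLeft_apply, mul_smul]⟩
  exact exists_rank_finrank_eq T (𝒟 := 𝒟) (A := A) (fun L => h𝒟 L) h1 hmul (fun k a ha => hAst k a ha)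
    (fun W hW hW0 hWst => hAirr W hW hW0 fun k f hf => hWst k f hf) hb ha₀ h0

/-- **`dim S(Σ_j ι_j b_j) · δ = dim D⟨b⟩ · dim A`** for `A` stable irreducible with ANY commutant, `ι_j` equivariant
and jointly independent on `A`, `b : J → A`.  File I9's `dim S = rank(b)·dim A` is the case `δ = 1`.
[cite: Lang2002, XVII §3] [cite: Serre1977, §2.6] [cite: Deligne1982HodgeCycles, I §3 Ex. 3.7] -/
theorem finrank_span_shadowCoeff_sum_mul_eq {A : Submodule ℚ (Y → ℚ)} {𝒟 : Submodule ℚ ((Y → ℚ) →ₗ[ℚ] (Y → ℚ))}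
    (h𝒟 : ∀ L : (Y → ℚ) →ₗ[ℚ] (Y → ℚ), L ∈ 𝒟 ↔ (∀ a ∈ A, L a ∈ A) ∧
      ∀ (k : G) (a : Y → ℚ), a ∈ A → L (fun y => a (k • y)) = fun y => L a (k • y))
    (hAst : ∀ (k : G) (a : Y → ℚ), a ∈ A → (fun y => a (k • y)) ∈ A)
    (hAirr : ∀ W : Submodule ℚ (Y → ℚ), W ≤ A → W ≠ ⊥ →
      (∀ (k : G) (f : Y → ℚ), f ∈ W → (fun y => f (k • y)) ∈ W) → W = A)
    {J : Type u} [Fintype J] (ι : J → ((Y → ℚ) →ₗ[ℚ] (Y₀ → ℚ)))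
    (hιeq : ∀ (j : J) (k : G) (a : Y → ℚ), a ∈ A → ι j (fun y => a (k • y)) = fun y => ι j a (k • y))
    (hind : ∀ f : J → (Y → ℚ), (∀ j, f j ∈ A) → ∑ j, ι j (f j) = 0 → ∀ j, f j = 0)
    {b : J → (Y → ℚ)} (hb : ∀ j, b j ∈ A) {a₀ : Y → ℚ} (ha₀ : a₀ ∈ A) (h0 : a₀ ≠ 0) :
    Module.finrank ℚ ↥(Submodule.span ℚ (Set.range fun y : Y₀ => fun g : G => (∑ j, ι j (b j)) (g • y))) *
        Module.finrank ℚ ↥(𝒟.map (LinearMap.applyₗ a₀)) =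
      Module.finrank ℚ ↥(⨆ j, 𝒟.map (LinearMap.applyₗ (b j))) * Module.finrank ℚ A := by
  obtain ⟨r, -, hD, hS⟩ := exists_rank_finrank_span_shadowCoeff_sum_eq h𝒟 hAst hAirr ι hιeq hind hb ha₀ h0
  rw [hD, hS]
  ring

/-! ### §2 Two pivots: the class defect -/

/-- **THE CLASS DEFECT COUNTS D-RELATIONS: `dim(S(w₀) ∩ S(w₁)) · δ = dim(D⟨b⟩ ∩ D⟨b′⟩) · dim A`.**  `A` stable
irreducible with ANY commutant `𝒟`; `w₀ = Σ_j ι_j(b_j)` on `Y₀`, `w₁ = Σ_k ι′_k(b′_k)` on `Y₁` for equivariant,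
jointly independent embeddings of `A`.  (Through the disjoint-union pivot `Y₀ ⊕ Y₁`: `S(w₀ ⊔ w₁) = S(w₀) + S(w₁)`,
`D⟨b ⊔ b′⟩ = D⟨b⟩ + D⟨b′⟩`, Grassmann on both sides.)  File I15 is the case `δ = 1`. [cite: Lang2002, XVII §3]
[cite: Serre1977, §2.6] [cite: Gordon1999HodgeAVSurvey, §3 Theorem (proof), 7.5–7.7] -/
theorem finrank_span_shadowCoeff_inf_mul_eq {A : Submodule ℚ (Y → ℚ)} {𝒟 : Submodule ℚ ((Y → ℚ) →ₗ[ℚ] (Y → ℚ))}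
    (h𝒟 : ∀ L : (Y → ℚ) →ₗ[ℚ] (Y → ℚ), L ∈ 𝒟 ↔ (∀ a ∈ A, L a ∈ A) ∧
      ∀ (k : G) (a : Y → ℚ), a ∈ A → L (fun y => a (k • y)) = fun y => L a (k • y))
    (hAst : ∀ (k : G) (a : Y → ℚ), a ∈ A → (fun y => a (k • y)) ∈ A)
    (hAirr : ∀ W : Submodule ℚ (Y → ℚ), W ≤ A → W ≠ ⊥ →
      (∀ (k : G) (f : Y → ℚ), f ∈ W → (fun y => f (k • y)) ∈ W) → W = A)
    {J₀ : Type u} {J₁ : Type u'} [Fintype J₀] [Fintype J₁]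
    (ι₀ : J₀ → ((Y → ℚ) →ₗ[ℚ] (Y₀ → ℚ))) (ι₁ : J₁ → ((Y → ℚ) →ₗ[ℚ] (Y₁ → ℚ)))
    (hι₀eq : ∀ (j : J₀) (k : G) (a : Y → ℚ), a ∈ A → ι₀ j (fun y => a (k • y)) = fun y => ι₀ j a (k • y))
    (hι₁eq : ∀ (j : J₁) (k : G) (a : Y → ℚ), a ∈ A → ι₁ j (fun y => a (k • y)) = fun y => ι₁ j a (k • y))
    (hind₀ : ∀ f : J₀ → (Y → ℚ), (∀ j, f j ∈ A) → ∑ j, ι₀ j (f j) = 0 → ∀ j, f j = 0)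
    (hind₁ : ∀ f : J₁ → (Y → ℚ), (∀ j, f j ∈ A) → ∑ j, ι₁ j (f j) = 0 → ∀ j, f j = 0)
    {b₀ : J₀ → (Y → ℚ)} {b₁ : J₁ → (Y → ℚ)} (hb₀ : ∀ j, b₀ j ∈ A) (hb₁ : ∀ j, b₁ j ∈ A)
    {a₀ : Y → ℚ} (ha₀ : a₀ ∈ A) (h0 : a₀ ≠ 0) :
    Module.finrank ℚ ↥(Submodule.span ℚ (Set.range fun y : Y₀ => fun g : G => (∑ j, ι₀ j (b₀ j)) (g • y)) ⊓
          Submodule.span ℚ (Set.range fun y : Y₁ => fun g : G => (∑ j, ι₁ j (b₁ j)) (g • y))) *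
        Module.finrank ℚ ↥(𝒟.map (LinearMap.applyₗ a₀)) =
      Module.finrank ℚ ↥((⨆ j, 𝒟.map (LinearMap.applyₗ (b₀ j))) ⊓ ⨆ j, 𝒟.map (LinearMap.applyₗ (b₁ j))) *
        Module.finrank ℚ A := by
  -- extension by zero to the disjoint-union pivot `Y₀ ⊕ Y₁` (as in file I9 §3)
  let E₀ : (Y₀ → ℚ) →ₗ[ℚ] (Y₀ ⊕ Y₁ → ℚ) :=
    { toFun := fun f => Sum.elim f 0
      map_add' := fun f f' => by funext z; cases z <;> simp
      map_smul' := fun t f => by funext z; cases z <;> simp }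
  let E₁ : (Y₁ → ℚ) →ₗ[ℚ] (Y₀ ⊕ Y₁ → ℚ) :=
    { toFun := fun f => Sum.elim 0 f
      map_add' := fun f f' => by funext z; cases z <;> simp
      map_smul' := fun t f => by funext z; cases z <;> simp }
  have hE₀ : ∀ (f : Y₀ → ℚ) (z : Y₀ ⊕ Y₁), E₀ f z = Sum.elim f (0 : Y₁ → ℚ) z := fun f z => rfl
  have hE₁ : ∀ (f : Y₁ → ℚ) (z : Y₀ ⊕ Y₁), E₁ f z = Sum.elim (0 : Y₀ → ℚ) f z := fun f z => rfl
  let ι : J₀ ⊕ J₁ → ((Y → ℚ) →ₗ[ℚ] (Y₀ ⊕ Y₁ → ℚ)) := Sum.elim (fun j => E₀ ∘ₗ ι₀ j) (fun j => E₁ ∘ₗ ι₁ j)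
  have hιeq : ∀ (s : J₀ ⊕ J₁) (k : G) (a : Y → ℚ), a ∈ A → ι s (fun y => a (k • y)) = fun z => ι s a (k • z) := by
    rintro (j | j) k a ha
    · show E₀ (ι₀ j (fun y => a (k • y))) = fun z => E₀ (ι₀ j a) (k • z)
      rw [hι₀eq j k a ha]
      funext z
      cases z with
      | inl y => rw [Sum.smul_inl, hE₀, hE₀]; rfl
      | inr y => rw [Sum.smul_inr, hE₀, hE₀]; rfl
    · show E₁ (ι₁ j (fun y => a (k • y))) = fun z => E₁ (ι₁ j a) (k • z)
      rw [hι₁eq j k a ha]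
      funext z
      cases z with
      | inl y => rw [Sum.smul_inl, hE₁, hE₁]; rfl
      | inr y => rw [Sum.smul_inr, hE₁, hE₁]; rfl
  have hsum : ∀ f : J₀ ⊕ J₁ → (Y → ℚ), ∑ s, ι s (f s) =
      E₀ (∑ j, ι₀ j (f (Sum.inl j))) + E₁ (∑ j, ι₁ j (f (Sum.inr j))) := fun f => by
    rw [Fintype.sum_sum_type, map_sum, map_sum]
    rfl
  have hind : ∀ f : J₀ ⊕ J₁ → (Y → ℚ), (∀ s, f s ∈ A) → ∑ s, ι s (f s) = 0 → ∀ s, f s = 0 := by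
    intro f hf h0'
    rw [hsum] at h0'
    have h₀ : ∑ j, ι₀ j (f (Sum.inl j)) = 0 := by
      funext y
      have h := congrFun h0' (Sum.inl y)
      simpa [hE₀, hE₁] using h
    have h₁ : ∑ j, ι₁ j (f (Sum.inr j)) = 0 := by
      funext y
      have h := congrFun h0' (Sum.inr y)
      simpa [hE₀, hE₁] using h
    rintro (j | j)
    · exact hind₀ (fun j => f (Sum.inl j)) (fun j => hf _) h₀ j
    · exact hind₁ (fun j => f (Sum.inr j)) (fun j => hf _) h₁ j
  have hb : ∀ s : J₀ ⊕ J₁, Sum.elim b₀ b₁ s ∈ A := by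
    rintro (j | j)
    · exact hb₀ j
    · exact hb₁ j
  -- the juxtaposed shadow on `Y₀ ⊕ Y₁` and its shadow-coefficient space `S(w₀) ⊔ S(w₁)`
  have hp : ∑ s, ι s (Sum.elim b₀ b₁ s) = E₀ (∑ j, ι₀ j (b₀ j)) + E₁ (∑ j, ι₁ j (b₁ j)) := by
    rw [hsum]
    rfl
  have hS : Submodule.span ℚ (Set.range fun z : Y₀ ⊕ Y₁ => fun g : G => (∑ s, ι s (Sum.elim b₀ b₁ s)) (g • z)) =
      Submodule.span ℚ (Set.range fun y : Y₀ => fun g : G => (∑ j, ι₀ j (b₀ j)) (g • y)) ⊔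
        Submodule.span ℚ (Set.range fun y : Y₁ => fun g : G => (∑ j, ι₁ j (b₁ j)) (g • y)) := by
    rw [← Submodule.span_union, ← Set.Sum.elim_range]
    congr 1
    congr 1
    funext z
    cases z with
    | inl y =>
      funext g
      rw [hp, Sum.smul_inl]
      simp [hE₀, hE₁]
    | inr y =>
      funext g
      rw [hp, Sum.smul_inr]
      simp [hE₀, hE₁]
  -- the juxtaposed D-span `D⟨b₀ ⊔ b₁⟩ = D⟨b₀⟩ ⊔ D⟨b₁⟩`
  have hD : (⨆ s, 𝒟.map (LinearMap.applyₗ (Sum.elim b₀ b₁ s))) =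
      (⨆ j, 𝒟.map (LinearMap.applyₗ (b₀ j))) ⊔ ⨆ j, 𝒟.map (LinearMap.applyₗ (b₁ j)) := by
    rw [iSup_sum]
    rfl
  have hsup := finrank_span_shadowCoeff_sum_mul_eq (Y₀ := Y₀ ⊕ Y₁) h𝒟 hAst hAirr ι hιeq hind hb ha₀ h0
  rw [hS, hD] at hsup
  have hU := finrank_span_shadowCoeff_sum_mul_eq h𝒟 hAst hAirr ι₀ hι₀eq hind₀ hb₀ ha₀ h0
  have hU' := finrank_span_shadowCoeff_sum_mul_eq h𝒟 hAst hAirr ι₁ hι₁eq hind₁ hb₁ ha₀ h0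
  haveI : FiniteDimensional ℚ ↥(Submodule.span ℚ (Set.range fun y : Y₀ => fun g : G =>
      (∑ j, ι₀ j (b₀ j)) (g • y))) := FiniteDimensional.span_of_finite ℚ (Set.finite_range _)
  haveI : FiniteDimensional ℚ ↥(Submodule.span ℚ (Set.range fun y : Y₁ => fun g : G =>
      (∑ j, ι₁ j (b₁ j)) (g • y))) := FiniteDimensional.span_of_finite ℚ (Set.finite_range _)
  have hgS := Submodule.finrank_sup_add_finrank_inf_eq
    (Submodule.span ℚ (Set.range fun y : Y₀ => fun g : G => (∑ j, ι₀ j (b₀ j)) (g • y)))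
    (Submodule.span ℚ (Set.range fun y : Y₁ => fun g : G => (∑ j, ι₁ j (b₁ j)) (g • y)))
  have hgD := Submodule.finrank_sup_add_finrank_inf_eq
    (⨆ j, 𝒟.map (LinearMap.applyₗ (b₀ j))) (⨆ j, 𝒟.map (LinearMap.applyₗ (b₁ j)))
  -- arithmetic: multiply Grassmann for the `S`'s by `δ`, Grassmann for the `D`'s by `dim A`, and cancel
  have key := congrArg (· * Module.finrank ℚ ↥(𝒟.map (LinearMap.applyₗ a₀))) hgS
  simp only [add_mul] at key
  rw [hsup, hU, hU', ← add_mul, ← hgD, add_mul] at key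
  exact Nat.add_left_cancel key

/-- **ADDITIVITY IFF THE D-SPANS MEET TRIVIALLY**: for `A ≠ 0`,
**`S(w₀) ∩ S(w₁) = 0 ⟺ D⟨b⟩ ∩ D⟨b′⟩ = 0`**. [cite: Lang2002, XVII §3] [cite: Serre1977, §2.6] -/
theorem span_shadowCoeff_inf_eq_bot_iff_iSup {A : Submodule ℚ (Y → ℚ)} {𝒟 : Submodule ℚ ((Y → ℚ) →ₗ[ℚ] (Y → ℚ))}
    (h𝒟 : ∀ L : (Y → ℚ) →ₗ[ℚ] (Y → ℚ), L ∈ 𝒟 ↔ (∀ a ∈ A, L a ∈ A) ∧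
      ∀ (k : G) (a : Y → ℚ), a ∈ A → L (fun y => a (k • y)) = fun y => L a (k • y))
    (hAst : ∀ (k : G) (a : Y → ℚ), a ∈ A → (fun y => a (k • y)) ∈ A)
    (hAirr : ∀ W : Submodule ℚ (Y → ℚ), W ≤ A → W ≠ ⊥ →
      (∀ (k : G) (f : Y → ℚ), f ∈ W → (fun y => f (k • y)) ∈ W) → W = A)
    (hA0 : A ≠ ⊥) {J₀ : Type u} {J₁ : Type u'} [Fintype J₀] [Fintype J₁]
    (ι₀ : J₀ → ((Y → ℚ) →ₗ[ℚ] (Y₀ → ℚ))) (ι₁ : J₁ → ((Y → ℚ) →ₗ[ℚ] (Y₁ → ℚ)))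
    (hι₀eq : ∀ (j : J₀) (k : G) (a : Y → ℚ), a ∈ A → ι₀ j (fun y => a (k • y)) = fun y => ι₀ j a (k • y))
    (hι₁eq : ∀ (j : J₁) (k : G) (a : Y → ℚ), a ∈ A → ι₁ j (fun y => a (k • y)) = fun y => ι₁ j a (k • y))
    (hind₀ : ∀ f : J₀ → (Y → ℚ), (∀ j, f j ∈ A) → ∑ j, ι₀ j (f j) = 0 → ∀ j, f j = 0)
    (hind₁ : ∀ f : J₁ → (Y → ℚ), (∀ j, f j ∈ A) → ∑ j, ι₁ j (f j) = 0 → ∀ j, f j = 0)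
    {b₀ : J₀ → (Y → ℚ)} {b₁ : J₁ → (Y → ℚ)} (hb₀ : ∀ j, b₀ j ∈ A) (hb₁ : ∀ j, b₁ j ∈ A) :
    Submodule.span ℚ (Set.range fun y : Y₀ => fun g : G => (∑ j, ι₀ j (b₀ j)) (g • y)) ⊓
        Submodule.span ℚ (Set.range fun y : Y₁ => fun g : G => (∑ j, ι₁ j (b₁ j)) (g • y)) = ⊥ ↔
      (⨆ j, 𝒟.map (LinearMap.applyₗ (b₀ j))) ⊓ (⨆ j, 𝒟.map (LinearMap.applyₗ (b₁ j))) = ⊥ := by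
  obtain ⟨a₀, ha₀, h0⟩ := Submodule.exists_mem_ne_zero_of_ne_bot hA0
  have h := finrank_span_shadowCoeff_inf_mul_eq h𝒟 hAst hAirr ι₀ ι₁ hι₀eq hι₁eq hind₀ hind₁ hb₀ hb₁ ha₀ h0
  haveI : FiniteDimensional ℚ ↥(Submodule.span ℚ (Set.range fun y : Y₀ => fun g : G => (∑ j, ι₀ j (b₀ j)) (g • y))) :=
    FiniteDimensional.span_of_finite ℚ (Set.finite_range _)
  haveI : FiniteDimensional ℚ ↥(Submodule.span ℚ (Set.range fun y : Y₀ => fun g : G => (∑ j, ι₀ j (b₀ j)) (g • y)) ⊓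
      Submodule.span ℚ (Set.range fun y : Y₁ => fun g : G => (∑ j, ι₁ j (b₁ j)) (g • y))) :=
    Submodule.finiteDimensional_of_le inf_le_left
  have hA : Module.finrank ℚ A ≠ 0 := fun h' => hA0 (Submodule.finrank_eq_zero.1 h')
  let T : G → (Y → ℚ) →ₗ[ℚ] (Y → ℚ) := fun k => LinearMap.funLeft ℚ ℚ (fun y : Y => k • y)
  have hδ : Module.finrank ℚ ↥(𝒟.map (LinearMap.applyₗ a₀)) ≠ 0 := by
    haveI : FiniteDimensional ℚ ↥(𝒟.map (LinearMap.applyₗ a₀)) :=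
      Submodule.finiteDimensional_of_le (map_applyₗ_le T (A := A) (fun L => h𝒟 L) ha₀)
    intro h'
    exact map_applyₗ_ne_bot T (A := A) (fun L => h𝒟 L) h0 (Submodule.finrank_eq_zero.1 h')
  rw [← Submodule.finrank_eq_zero, ← Submodule.finrank_eq_zero]
  constructor
  · intro h0'
    rw [h0', zero_mul] at h
    rcases mul_eq_zero.1 h.symm with h1 | h1
    · exact h1
    · exact absurd h1 hA
  · intro h0'
    rw [h0', zero_mul] at h
    rcases mul_eq_zero.1 h with h1 | h1
    · exact h1
    · exact absurd h1 hδ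

/-- **THE CLASS DEFECT IS AN EXACT MULTIPLE OF `dim A`**: there is `m` (the D-dimension of `D⟨b⟩ ∩ D⟨b′⟩`) with
**`dim(D⟨b⟩ ∩ D⟨b′⟩) = m·δ` and `dim(S(w₀) ∩ S(w₁)) = m·dim A`** — file I5's `dim A ∣ defect` with the multiplier
identified for ANY irreducible class. [cite: Lang2002, XVII §3] [cite: Serre1977, §2.6]
[cite: Gordon1999HodgeAVSurvey, §3 Theorem (proof), 7.5–7.7] -/
theorem exists_finrank_span_shadowCoeff_inf_eq_mul {A : Submodule ℚ (Y → ℚ)}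
    {𝒟 : Submodule ℚ ((Y → ℚ) →ₗ[ℚ] (Y → ℚ))}
    (h𝒟 : ∀ L : (Y → ℚ) →ₗ[ℚ] (Y → ℚ), L ∈ 𝒟 ↔ (∀ a ∈ A, L a ∈ A) ∧
      ∀ (k : G) (a : Y → ℚ), a ∈ A → L (fun y => a (k • y)) = fun y => L a (k • y))
    (hAst : ∀ (k : G) (a : Y → ℚ), a ∈ A → (fun y => a (k • y)) ∈ A)
    (hAirr : ∀ W : Submodule ℚ (Y → ℚ), W ≤ A → W ≠ ⊥ →
      (∀ (k : G) (f : Y → ℚ), f ∈ W → (fun y => f (k • y)) ∈ W) → W = A)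
    {J₀ : Type u} {J₁ : Type u'} [Fintype J₀] [Fintype J₁]
    (ι₀ : J₀ → ((Y → ℚ) →ₗ[ℚ] (Y₀ → ℚ))) (ι₁ : J₁ → ((Y → ℚ) →ₗ[ℚ] (Y₁ → ℚ)))
    (hι₀eq : ∀ (j : J₀) (k : G) (a : Y → ℚ), a ∈ A → ι₀ j (fun y => a (k • y)) = fun y => ι₀ j a (k • y))
    (hι₁eq : ∀ (j : J₁) (k : G) (a : Y → ℚ), a ∈ A → ι₁ j (fun y => a (k • y)) = fun y => ι₁ j a (k • y))
    (hind₀ : ∀ f : J₀ → (Y → ℚ), (∀ j, f j ∈ A) → ∑ j, ι₀ j (f j) = 0 → ∀ j, f j = 0)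
    (hind₁ : ∀ f : J₁ → (Y → ℚ), (∀ j, f j ∈ A) → ∑ j, ι₁ j (f j) = 0 → ∀ j, f j = 0)
    {b₀ : J₀ → (Y → ℚ)} {b₁ : J₁ → (Y → ℚ)} (hb₀ : ∀ j, b₀ j ∈ A) (hb₁ : ∀ j, b₁ j ∈ A)
    {a₀ : Y → ℚ} (ha₀ : a₀ ∈ A) (h0 : a₀ ≠ 0) :
    ∃ m : ℕ,
      Module.finrank ℚ ↥((⨆ j, 𝒟.map (LinearMap.applyₗ (b₀ j))) ⊓ ⨆ j, 𝒟.map (LinearMap.applyₗ (b₁ j))) =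
        m * Module.finrank ℚ ↥(𝒟.map (LinearMap.applyₗ a₀)) ∧
      Module.finrank ℚ ↥(Submodule.span ℚ (Set.range fun y : Y₀ => fun g : G => (∑ j, ι₀ j (b₀ j)) (g • y)) ⊓
          Submodule.span ℚ (Set.range fun y : Y₁ => fun g : G => (∑ j, ι₁ j (b₁ j)) (g • y))) =
        m * Module.finrank ℚ A := by
  let T : G → (Y → ℚ) →ₗ[ℚ] (Y → ℚ) := fun k => LinearMap.funLeft ℚ ℚ (fun y : Y => k • y)
  have h1 : ∃ i₀ : G, T i₀ = LinearMap.id :=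
    ⟨1, LinearMap.ext fun f => funext fun y => by simp [T, LinearMap.funLeft_apply]⟩
  have hmul : ∀ i i' : G, ∃ i'' : G, T i'' = T i ∘ₗ T i' :=
    fun i i' => ⟨i' * i, LinearMap.ext fun f => funext fun y => by simp [T, LinearMap.funLeft_apply, mul_smul]⟩
  obtain ⟨m, hm⟩ := finrank_map_applyₗ_dvd_finrank_iSup_inf_iSup T (𝒟 := 𝒟) (A := A) (fun L => h𝒟 L) h1 hmul
    (fun k a ha => hAst k a ha) (fun W hW hW0 hWst => hAirr W hW hW0 fun k f hf => hWst k f hf) ha₀ h0 b₁ hb₀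
  have h := finrank_span_shadowCoeff_inf_mul_eq h𝒟 hAst hAirr ι₀ ι₁ hι₀eq hι₁eq hind₀ hind₁ hb₀ hb₁ ha₀ h0
  have hδ : Module.finrank ℚ ↥(𝒟.map (LinearMap.applyₗ a₀)) ≠ 0 := by
    haveI : FiniteDimensional ℚ ↥(𝒟.map (LinearMap.applyₗ a₀)) :=
      Submodule.finiteDimensional_of_le (map_applyₗ_le T (A := A) (fun L => h𝒟 L) ha₀)
    intro h'
    exact map_applyₗ_ne_bot T (A := A) (fun L => h𝒟 L) h0 (Submodule.finrank_eq_zero.1 h')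
  refine ⟨m, by rw [hm, mul_comm], Nat.eq_of_mul_eq_mul_right (Nat.pos_of_ne_zero hδ) ?_⟩
  rw [h, hm]
  ring

/-! ### §3 One component per side: the commutant certificate -/

/-- **ONE COMPONENT PER SIDE: `dim(S(ι b) ∩ S(ι′ b′)) · δ = dim(D·b ∩ D·b′) · dim A`** (single equivariant
embeddings `ι`, `ι′`, injective on `A`). [cite: Lang2002, XVII §3] [cite: Gordon1999HodgeAVSurvey, §3 Theorem
(proof), 7.5–7.7] -/
theorem finrank_span_shadowCoeff_inf_mul_eq_single {A : Submodule ℚ (Y → ℚ)}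
    {𝒟 : Submodule ℚ ((Y → ℚ) →ₗ[ℚ] (Y → ℚ))}
    (h𝒟 : ∀ L : (Y → ℚ) →ₗ[ℚ] (Y → ℚ), L ∈ 𝒟 ↔ (∀ a ∈ A, L a ∈ A) ∧
      ∀ (k : G) (a : Y → ℚ), a ∈ A → L (fun y => a (k • y)) = fun y => L a (k • y))
    (hAst : ∀ (k : G) (a : Y → ℚ), a ∈ A → (fun y => a (k • y)) ∈ A)
    (hAirr : ∀ W : Submodule ℚ (Y → ℚ), W ≤ A → W ≠ ⊥ →
      (∀ (k : G) (f : Y → ℚ), f ∈ W → (fun y => f (k • y)) ∈ W) → W = A)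
    (ι₀ : (Y → ℚ) →ₗ[ℚ] (Y₀ → ℚ)) (ι₁ : (Y → ℚ) →ₗ[ℚ] (Y₁ → ℚ))
    (hι₀eq : ∀ (k : G) (a : Y → ℚ), a ∈ A → ι₀ (fun y => a (k • y)) = fun y => ι₀ a (k • y))
    (hι₁eq : ∀ (k : G) (a : Y → ℚ), a ∈ A → ι₁ (fun y => a (k • y)) = fun y => ι₁ a (k • y))
    (hinj₀ : ∀ f ∈ A, ι₀ f = 0 → f = 0) (hinj₁ : ∀ f ∈ A, ι₁ f = 0 → f = 0)
    {b₀ b₁ : Y → ℚ} (hb₀ : b₀ ∈ A) (hb₁ : b₁ ∈ A) {a₀ : Y → ℚ} (ha₀ : a₀ ∈ A) (h0 : a₀ ≠ 0) :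
    Module.finrank ℚ ↥(Submodule.span ℚ (Set.range fun y : Y₀ => fun g : G => ι₀ b₀ (g • y)) ⊓
          Submodule.span ℚ (Set.range fun y : Y₁ => fun g : G => ι₁ b₁ (g • y))) *
        Module.finrank ℚ ↥(𝒟.map (LinearMap.applyₗ a₀)) =
      Module.finrank ℚ ↥(𝒟.map (LinearMap.applyₗ b₀) ⊓ 𝒟.map (LinearMap.applyₗ b₁)) * Module.finrank ℚ A := by
  have h := finrank_span_shadowCoeff_inf_mul_eq h𝒟 hAst hAirr (J₀ := Unit) (J₁ := Unit) (fun _ => ι₀) (fun _ => ι₁)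
    (fun _ k a ha => hι₀eq k a ha) (fun _ k a ha => hι₁eq k a ha)
    (fun f hf hf0 j => by
      cases j
      exact hinj₀ _ (hf _) (by rw [← hf0]; exact (Fintype.sum_unique fun j => ι₀ (f j)).symm))
    (fun f hf hf0 j => by
      cases j
      exact hinj₁ _ (hf _) (by rw [← hf0]; exact (Fintype.sum_unique fun j => ι₁ (f j)).symm))
    (b₀ := fun _ => b₀) (b₁ := fun _ => b₁) (fun _ => hb₀) (fun _ => hb₁) ha₀ h0
  rw [Fintype.sum_unique, Fintype.sum_unique, iSup_const, iSup_const] at h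
  exact h

/-- **THE COMMUTANT CERTIFICATE**: one component per side, `b, b′ ≠ 0`; the defect is **`dim A` if `b′ ∈ D·b`**
and **`0` otherwise** (two D-lines are equal or disjoint, file C1) — gen 69's dichotomy `{0, dim A}` with its exact
criterion for an ARBITRARY commutant (for a scalar commutant: `b′ ∈ ℚb`). [cite: Lang2002, XVII §3]
[cite: CurtisReiner1962, §27 (27.3)] [cite: Gordon1999HodgeAVSurvey, §3 Theorem (proof), 7.5–7.7] -/
theorem finrank_span_shadowCoeff_inf_eq_ite_single {A : Submodule ℚ (Y → ℚ)}
    {𝒟 : Submodule ℚ ((Y → ℚ) →ₗ[ℚ] (Y → ℚ))}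
    (h𝒟 : ∀ L : (Y → ℚ) →ₗ[ℚ] (Y → ℚ), L ∈ 𝒟 ↔ (∀ a ∈ A, L a ∈ A) ∧
      ∀ (k : G) (a : Y → ℚ), a ∈ A → L (fun y => a (k • y)) = fun y => L a (k • y))
    (hAst : ∀ (k : G) (a : Y → ℚ), a ∈ A → (fun y => a (k • y)) ∈ A)
    (hAirr : ∀ W : Submodule ℚ (Y → ℚ), W ≤ A → W ≠ ⊥ →
      (∀ (k : G) (f : Y → ℚ), f ∈ W → (fun y => f (k • y)) ∈ W) → W = A)
    (ι₀ : (Y → ℚ) →ₗ[ℚ] (Y₀ → ℚ)) (ι₁ : (Y → ℚ) →ₗ[ℚ] (Y₁ → ℚ))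
    (hι₀eq : ∀ (k : G) (a : Y → ℚ), a ∈ A → ι₀ (fun y => a (k • y)) = fun y => ι₀ a (k • y))
    (hι₁eq : ∀ (k : G) (a : Y → ℚ), a ∈ A → ι₁ (fun y => a (k • y)) = fun y => ι₁ a (k • y))
    (hinj₀ : ∀ f ∈ A, ι₀ f = 0 → f = 0) (hinj₁ : ∀ f ∈ A, ι₁ f = 0 → f = 0)
    {b₀ b₁ : Y → ℚ} (hb₀ : b₀ ∈ A) (hb₀0 : b₀ ≠ 0) (hb₁ : b₁ ∈ A) (hb₁0 : b₁ ≠ 0) :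
    Module.finrank ℚ ↥(Submodule.span ℚ (Set.range fun y : Y₀ => fun g : G => ι₀ b₀ (g • y)) ⊓
        Submodule.span ℚ (Set.range fun y : Y₁ => fun g : G => ι₁ b₁ (g • y))) =
      if b₁ ∈ 𝒟.map (LinearMap.applyₗ b₀) then Module.finrank ℚ A else 0 := by
  let T : G → (Y → ℚ) →ₗ[ℚ] (Y → ℚ) := fun k => LinearMap.funLeft ℚ ℚ (fun y : Y => k • y)
  have h𝒟' : ∀ L : (Y → ℚ) →ₗ[ℚ] (Y → ℚ), L ∈ 𝒟 ↔ (∀ a ∈ A, L a ∈ A) ∧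
      ∀ (k : G) (a : Y → ℚ), a ∈ A → L (T k a) = T k (L a) := fun L => h𝒟 L
  have hAst' : ∀ (k : G) (a : Y → ℚ), a ∈ A → T k a ∈ A := fun k a ha => hAst k a ha
  have hAirr' : ∀ W : Submodule ℚ (Y → ℚ), W ≤ A → W ≠ ⊥ →
      (∀ (k : G) (f : Y → ℚ), f ∈ W → T k f ∈ W) → W = A :=
    fun W hW hW0 hWst => hAirr W hW hW0 fun k f hf => hWst k f hf
  have h := finrank_span_shadowCoeff_inf_mul_eq_single h𝒟 hAst hAirr ι₀ ι₁ hι₀eq hι₁eq hinj₀ hinj₁ hb₀ hb₁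
    hb₀ hb₀0
  haveI : FiniteDimensional ℚ ↥(𝒟.map (LinearMap.applyₗ b₀)) :=
    Submodule.finiteDimensional_of_le (map_applyₗ_le T h𝒟' hb₀)
  have hδ : Module.finrank ℚ ↥(𝒟.map (LinearMap.applyₗ b₀)) ≠ 0 := fun h' =>
    map_applyₗ_ne_bot T h𝒟' hb₀0 (Submodule.finrank_eq_zero.1 h')
  rcases map_applyₗ_eq_or_inf_eq_bot T h𝒟' hAst' hAirr' hb₀ hb₁ with heq | hbot
  · -- equal D-lines: `b₁ ∈ D·b₀`, defect `dim A`
    have hmem : b₁ ∈ 𝒟.map (LinearMap.applyₗ b₀) := heq ▸ self_mem_map_applyₗ T h𝒟' b₁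
    rw [if_pos hmem]
    rw [← heq, inf_idem, mul_comm (Module.finrank ℚ ↥(𝒟.map (LinearMap.applyₗ b₀)))] at h
    exact Nat.eq_of_mul_eq_mul_right (Nat.pos_of_ne_zero hδ) h
  · -- disjoint D-lines: `b₁ ∉ D·b₀` (as `b₁ ≠ 0`), defect `0`
    have hnot : b₁ ∉ 𝒟.map (LinearMap.applyₗ b₀) := fun hmem =>
      hb₁0 ((Submodule.mem_bot ℚ).1 (hbot ▸ (⟨hmem, self_mem_map_applyₗ T h𝒟' b₁⟩ :
        b₁ ∈ 𝒟.map (LinearMap.applyₗ b₀) ⊓ 𝒟.map (LinearMap.applyₗ b₁))))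
    rw [if_neg hnot]
    rw [hbot, finrank_bot, zero_mul] at h
    rcases mul_eq_zero.1 h with h1 | h1
    · exact h1
    · exact absurd h1 hδ

end Summit.HodgeConjecture.CorCM.IrrOdd

end
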